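import Literature.AnabelianGeometry.SemiGraphs.UniformSplittingProofs
import Literature.AnabelianGeometry.SemiGraphs.BTempPointFibres
import Literature.AnabelianGeometry.SemiGraphs.TemperedChartTransport
import Literature.AnabelianGeometry.SemiGraphs.TemperedDecompositionCompact
import Literature.AnabelianGeometry.SemiGraphs.TemperoidsCountablyConnectedTransport
import Literature.AlgebraicGeometry.Frobenioids.QuasiTemperoidConnected
import HarnessLib

/-!
# The tempered fundamental group of a covering semi-graph of anabelioids is an open stabiliser

Mochizuki, *Semi-graphs of anabelioids*, Publ. RIMS **42** (2006), §3, Proposition 3.6 (v) p. 39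
("Suppose that `G` is coherent, and that we are given a tempered covering `G' → G`. Then the resulting
morphism of temperoids `B^temp(G') → B^temp(G)` is étale") with Definition 3.4 (i) p. 36 (étale =
"isomorphic to `T_T → T`") and Proposition 3.2 p. 35 (morphisms of connected temperoids come from
continuous homomorphisms of the groups, unique up to conjugation) [cite: MochizukiSemiAnbd2006,
Prop 3.6(v) p.39]: at the level of GROUPS these say that, for `S` a CONNECTED tempered covering of `G`
with covering semi-graph of anabelioids `G_S` (`CovObj.coveringGraph`), any tempered fundamental group
`π₁^temp(G_S)` (any `TemperedPiChart` of `G_S`) is isomorphic, compatibly with the chart equivalences,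
to the OPEN stabiliser in `π₁^temp(G)` of a point of the transitive `π₁^temp(G)`-set `S`.

Proof-only companion (abc-iut cell, L3 route T «(iii)/(iv) At transfer along tempered coverings»,
brick T1; L3-lead ruling α42 (3)): the composite of EXPLICIT equivalences
`B^temp(π₁^temp(G_S)) ≌ B^temp(G_S) ≌ B^temp(G)_S ≌ B^temp(π₁^temp(G))_{X_S} ≌ B^temp(Stab(x₀))`
(chart of `G_S`; `CovObj.etaleEquiv` with `uniformSplitting_holds`; `Over.postEquiv` of the chart of
`G`; the point-fibre functor `BTemp.fibreFamily _ ⋙ Pi.eval _ ω₀` at the unique orbit) is turned into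
mutually inverse continuous homomorphisms by Proposition 3.2 (`TemperoidHomEqRes_holds`,
`BTemp.exists_conj_of_natTrans`), exactly as for two charts of one graph
(`TemperedPiChart.exists_compatIso`).  General lemmas: `BTemp.exists_compatIso_of_equivalence`
(any equivalence `B^temp(Π₁) ≌ B^temp(Π₂)` of tempered second-countable groups is `B^temp` of a
topological isomorphism), the private `Pi.eval_isEquivalence_of_unique`.  No definitions; nothing here bears on
[IUTchIII] Cor. 3.12.
-/

noncomputable section

open CategoryTheory CategoryTheory.Limits Topology

namespace Literature.AnabelianGeometry.SemiGraphs

open Literature.AlgebraicGeometry.Frobenioids (IsConnectedObj)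
open Literature.AlgebraicGeometry.Frobenioids.QuasiTemperoid.BTempConnected (ρ_one_apply ρ_mul_apply
  ρ_inv_apply exists_ρ_eq_of_isConnectedObj)

universe w v₁ u₁ u

/-! ### Evaluation at the point of a one-point index type is an equivalence -/

section PiUnique

variable {I : Type w} [Unique I] (C : I → Type u₁) [∀ i, Category.{v₁} (C i)]

/-- For a one-element index type, evaluation `(∀ i, C i) ⥤ C default` is faithful. [folklore] -/
private theorem Pi.eval_faithful_of_unique : (Pi.eval C default).Faithful where
  map_injective {X Y} f g h := by
    funext i
    obtain rfl : i = default := Unique.eq_default i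
    exact h

/-- For a one-element index type, evaluation `(∀ i, C i) ⥤ C default` is full. [folklore] -/
private theorem Pi.eval_full_of_unique : (Pi.eval C default).Full where
  map_surjective {X Y} h := by
    refine ⟨fun i => (Unique.eq_default i).symm ▸ h, ?_⟩
    rfl

/-- For a one-element index type, evaluation `(∀ i, C i) ⥤ C default` is essentially surjective.
[folklore] -/
private theorem Pi.eval_essSurj_of_unique : (Pi.eval C default).EssSurj where
  mem_essImage Y :=
    ⟨fun i => (Pi.eqToEquivalence C (Unique.default_eq i)).functor.obj Y, ⟨Iso.refl _⟩⟩

/-- **For a one-element index type, evaluation `(∀ i, C i) ⥤ C default` is an equivalence of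
categories.** [folklore] -/
private theorem Pi.eval_isEquivalence_of_unique : (Pi.eval C default).IsEquivalence :=
  haveI := Pi.eval_faithful_of_unique C
  haveI := Pi.eval_full_of_unique C
  haveI := Pi.eval_essSurj_of_unique C
  { }

end PiUnique

/-! ### An equivalence `B^temp(Π₁) ≌ B^temp(Π₂)` is `B^temp` of a topological isomorphism -/

namespace BTemp

variable {G : Type u} [Group G] [TopologicalSpace G]

/-- **Proposition 3.2 for an equivalence** ([SemiAnbd] §3 p. 35, "any isomorphism of connected
temperoids `B^temp(Π₁) ⥲ B^temp(Π₂)` arises from an isomorphism `Π₁ ⥲ Π₂`, unique up to inner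
automorphism"): for tempered, second-countable `Π₁`, `Π₂` and an equivalence
`E : B^temp(Π₁) ≌ B^temp(Π₂)` there are mutually inverse continuous homomorphisms `φ : Π₂ → Π₁`,
`ψ : Π₁ → Π₂` with `E ≅ B^temp(φ)` and `E⁻¹ ≅ B^temp(ψ)`. [cite: MochizukiSemiAnbd2006, Prop 3.2 p.35] -/
theorem exists_compatIso_of_equivalence {G₁ G₂ : Type u} [Group G₁] [TopologicalSpace G₁]
    [IsTopologicalGroup G₁] [SecondCountableTopology G₁] [Group G₂] [TopologicalSpace G₂]
    [IsTopologicalGroup G₂] [SecondCountableTopology G₂] (h₁ : IsTempered G₁) (h₂ : IsTempered G₂)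
    (E : BTemp G₁ ≌ BTemp G₂) :
    ∃ (φ : G₂ →ₜ* G₁) (ψ : G₁ →ₜ* G₂), (∀ x, ψ (φ x) = x) ∧ (∀ y, φ (ψ y) = y) ∧
      Nonempty (E.functor ≅ BTemp.res φ) ∧ Nonempty (E.inverse ≅ BTemp.res ψ) := by
  -- the natural transformations `𝟭 ⟶ B^temp(id)` (componentwise the identity)
  let η₁ : 𝟭 (BTemp G₁) ⟶ BTemp.res (ContinuousMonoidHom.id G₁) :=
    { app := fun X => BTemp.homOfEquivariant X ((BTemp.res (ContinuousMonoidHom.id G₁)).obj X) id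
        fun _ _ => rfl
      naturality := fun X Y f => by
        apply ObjectProperty.hom_ext
        apply Action.Hom.ext
        exact ConcreteCategory.hom_ext _ _ fun _ => rfl }
  let η₂ : 𝟭 (BTemp G₂) ⟶ BTemp.res (ContinuousMonoidHom.id G₂) :=
    { app := fun X => BTemp.homOfEquivariant X ((BTemp.res (ContinuousMonoidHom.id G₂)).obj X) id
        fun _ _ => rfl
      naturality := fun X Y f => by
        apply ObjectProperty.hom_ext
        apply Action.Hom.ext
        exact ConcreteCategory.hom_ext _ _ fun _ => rfl }
  -- Proposition 3.2 (surjectivity half) for the two directions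
  haveI : PreservesFiniteLimits E.functor := ⟨fun J _ _ => inferInstance⟩
  haveI : PreservesFiniteLimits E.inverse := ⟨fun J _ _ => inferInstance⟩
  let Φ₁ : TemperoidHom (BTemp G₂) (BTemp G₁) := ⟨E.functor, inferInstance, fun J _ _ => inferInstance⟩
  let Φ₂ : TemperoidHom (BTemp G₁) (BTemp G₂) := ⟨E.inverse, inferInstance, fun J _ _ => inferInstance⟩
  obtain ⟨φ, ⟨iφ⟩⟩ := TemperoidHomEqRes_holds G₂ G₁ h₂ h₁ Φ₁
  obtain ⟨ψ₀, ⟨iψ⟩⟩ := TemperoidHomEqRes_holds G₁ G₂ h₁ h₂ Φ₂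
  change E.functor ≅ BTemp.res φ at iφ
  change E.inverse ≅ BTemp.res ψ₀ at iψ
  -- `B^temp(φ ∘ ψ₀) ≅ E ⋙ E⁻¹ ≅ 𝟭`, hence `φ ∘ ψ₀` is inner
  have h1 : ∃ g : G₁, ∀ a : G₁, g * φ (ψ₀ a) * g⁻¹ = a := by
    let i1 : BTemp.res (φ.comp ψ₀) ≅ 𝟭 (BTemp G₁) :=
      (Functor.isoWhiskerRight iφ.symm (BTemp.res ψ₀) ≪≫ Functor.isoWhiskerLeft E.functor iψ.symm :
          BTemp.res φ ⋙ BTemp.res ψ₀ ≅ E.functor ⋙ E.inverse) ≪≫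
      E.unitIso.symm
    obtain ⟨g, hg, -⟩ := BTemp.exists_conj_of_natTrans h₁ (φ.comp ψ₀)
      (ContinuousMonoidHom.id G₁) (i1.hom ≫ η₁)
    exact ⟨g, fun a => by simpa using hg a⟩
  -- `B^temp(ψ₀ ∘ φ) ≅ E⁻¹ ⋙ E ≅ 𝟭`, hence `ψ₀ ∘ φ` is inner
  have h2 : ∃ g : G₂, ∀ b : G₂, g * ψ₀ (φ b) * g⁻¹ = b := by
    let i2 : BTemp.res (ψ₀.comp φ) ≅ 𝟭 (BTemp G₂) :=
      (Functor.isoWhiskerRight iψ.symm (BTemp.res φ) ≪≫ Functor.isoWhiskerLeft E.inverse iφ.symm :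
          BTemp.res ψ₀ ⋙ BTemp.res φ ≅ E.inverse ⋙ E.functor) ≪≫
      E.counitIso
    obtain ⟨g, hg, -⟩ := BTemp.exists_conj_of_natTrans h₂ (ψ₀.comp φ)
      (ContinuousMonoidHom.id G₂) (i2.hom ≫ η₂)
    exact ⟨g, fun b => by simpa using hg b⟩
  obtain ⟨g, hg⟩ := h1
  obtain ⟨g', hg'⟩ := h2
  -- the corrected inverse `ψ := ψ₀ ∘ conj(g)`
  let κ : G₁ →ₜ* G₁ :=
    { toMonoidHom := (MulAut.conj g).toMonoidHom
      continuous_toFun := by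
        change Continuous fun x => g * x * g⁻¹
        fun_prop }
  have hκ : ∀ x, κ x = g * x * g⁻¹ := fun _ => rfl
  let ψ : G₁ →ₜ* G₂ := ψ₀.comp κ
  have hψ : ∀ y, ψ y = ψ₀ (g * y * g⁻¹) := fun _ => rfl
  have hφψ : ∀ y, φ (ψ y) = y := by
    intro y
    have e1 := hg (g * y * g⁻¹)
    have e2 : φ (ψ₀ (g * y * g⁻¹)) = y := by
      have := congrArg (fun z => g⁻¹ * z * g) e1
      simpa [mul_assoc] using this
    rw [hψ]
    exact e2
  have hinj : Function.Injective φ := by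
    intro b₁ b₂ h
    have := congrArg (fun z => g' * ψ₀ z * g'⁻¹) h
    simpa [hg'] using this
  have hψφ : ∀ x, ψ (φ x) = x := fun x => hinj (hφψ (φ x))
  refine ⟨φ, ψ, hψφ, hφψ, ⟨iφ⟩, ⟨iψ ≪≫ BTemp.resIsoOfConj ψ₀ ψ (ψ₀ g) fun a => ?_⟩⟩
  rw [hψ, map_mul, map_mul, map_inv]

end BTemp

/-! ### The chart group of a covering semi-graph of anabelioids -/

namespace ProfiniteSemiGraph

namespace CovObj

variable {𝒢 : ProfiniteSemiGraph.{u}}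

/-- The image under a chart of a CONNECTED tempered covering is a transitive `π₁^temp(G)`-set: every
point is a translate of the chosen base point. [cite: MochizukiSemiAnbd2006, Prop 3.6(ii) p.38] -/
theorem exists_ρ_eq_of_isConnectedObj_chart (c : TemperedPiChart 𝒢) (S : CovObj 𝒢) (hS : S.IsTempered)
    (hSc : IsConnectedObj (⟨S, hS⟩ : BTempCat 𝒢)) (x₀ x : (c.equiv.functor.obj ⟨S, hS⟩).obj.V) :
    ∃ g : c.G, (c.equiv.functor.obj ⟨S, hS⟩).obj.ρ g x₀ = x :=
  exists_ρ_eq_of_isConnectedObj _ (TemperoidTransport.isConnectedObj_functor_obj c.equiv hSc) x₀ x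

/-- For a connected tempered covering `S`, the orbit set of its chart image has exactly one element;
we record the resulting `Unique` structure with a prescribed default orbit `ω₀`.
[cite: MochizukiSemiAnbd2006, Prop 3.6(ii) p.38] -/
theorem orbits_eq_of_isConnectedObj_chart (c : TemperedPiChart 𝒢) (S : CovObj 𝒢) (hS : S.IsTempered)
    (hSc : IsConnectedObj (⟨S, hS⟩ : BTempCat 𝒢)) (ω₀ ω : BTemp.Orbits (c.equiv.functor.obj ⟨S, hS⟩)) :
    ω = ω₀ := by
  induction ω using Quot.ind with
  | _ x =>
    rw [← Quot.out_eq ω₀]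
    obtain ⟨g, hg⟩ := exists_ρ_eq_of_isConnectedObj_chart c S hS hSc (Quot.out ω₀) x
    exact (BTemp.cl_eq_cl_iff _ _ _).mpr ⟨g⁻¹, by rw [← hg, ρ_inv_apply]⟩

/-- **`π₁^temp(G_S)` is the open stabiliser of a point of `S`, compatibly with the charts**
([SemiAnbd] Prop. 3.6 (v) p. 39 with Def. 3.4 (i) p. 36 and Prop. 3.2 p. 35): for `G` as in
Proposition 3.6 and coherent, `c` a chart of `G` (so `B^temp(G) ≌ B^temp(Π)`, `Π = c.G`), `S` a
connected tempered covering with chart image `X_S`, `ω₀` its (unique) orbit with base point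
`x₀ = Quot.out ω₀` and stabiliser `U = Stab_Π(x₀)` (an OPEN subgroup), and `c_S` ANY chart of the
covering semi-graph of anabelioids `G_S`: there are mutually inverse continuous homomorphisms
`φ : U → π₁^temp(G_S)`, `ψ : π₁^temp(G_S) → U` such that `B^temp(φ)` is the composite of explicit
equivalences `B^temp(π₁^temp(G_S)) ≌ B^temp(G_S) ≌ B^temp(G)_S ≌ B^temp(Π)_{X_S} ≌ B^temp(U)` (chart of
`G_S`, étale equivalence of Prop. 3.6 (v), slice of the chart of `G`, point fibre at `x₀`).
[cite: MochizukiSemiAnbd2006, Prop 3.6(v) p.39] -/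
theorem exists_chartGroup_compatIso (h36 : 𝒢.Prop36Hypotheses) (hcoh : 𝒢.IsCoherent)
    (c : TemperedPiChart 𝒢) (S : CovObj 𝒢) (hS : S.IsTempered)
    (hSc : IsConnectedObj (⟨S, hS⟩ : BTempCat 𝒢)) (cS : TemperedPiChart S.coveringGraph)
    (ω₀ : BTemp.Orbits (c.equiv.functor.obj ⟨S, hS⟩)) :
    ∃ (φ : BTemp.stab (c.equiv.functor.obj ⟨S, hS⟩) (Quot.out ω₀) →ₜ* cS.G)
      (ψ : cS.G →ₜ* BTemp.stab (c.equiv.functor.obj ⟨S, hS⟩) (Quot.out ω₀)),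
      (∀ x, ψ (φ x) = x) ∧ (∀ y, φ (ψ y) = y) ∧
      Nonempty (cS.equiv.inverse ⋙ (S.etaleEquiv uniformSplitting_holds h36 hcoh hS).functor ⋙
          (Over.postEquiv (⟨S, hS⟩ : BTempCat 𝒢) c.equiv).functor ⋙
          BTemp.fibreFamily (c.equiv.functor.obj ⟨S, hS⟩) ⋙
          Pi.eval (fun ω => BTemp (BTemp.stab (c.equiv.functor.obj ⟨S, hS⟩) (Quot.out ω))) ω₀ ≅
        BTemp.res φ) := by
  haveI := c.secondCountableTopology
  haveI := cS.secondCountableTopology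
  -- notation
  let X : BTemp c.G := c.equiv.functor.obj ⟨S, hS⟩
  let U : Subgroup c.G := BTemp.stab X (Quot.out ω₀)
  have hUo : IsOpen (U : Set c.G) := X.property.2 _
  have hUt : Literature.AnabelianGeometry.SemiGraphs.IsTempered U :=
    c.isTempered.subgroup_of_isClosed U (U.isClosed_of_isOpen hUo)
  -- the point-fibre functor at the unique orbit is an equivalence
  letI : Unique (BTemp.Orbits X) := ⟨⟨ω₀⟩, fun ω => orbits_eq_of_isConnectedObj_chart c S hS hSc ω₀ ω⟩
  haveI : (BTemp.fibreFamily X).IsEquivalence :=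
    BTemp.fibreFamily_isEquivalence (fun V hV => c.isTempered.countable_quotient V hV) X
  haveI : (Pi.eval (fun ω => BTemp (BTemp.stab X (Quot.out ω))) ω₀).IsEquivalence :=
    Pi.eval_isEquivalence_of_unique (fun ω => BTemp (BTemp.stab X (Quot.out ω)))
  let F := BTemp.fibreFamily X ⋙ Pi.eval (fun ω => BTemp (BTemp.stab X (Quot.out ω))) ω₀
  haveI : F.IsEquivalence := Functor.isEquivalence_trans _ _
  -- the composite equivalence `B^temp(c_S.G) ≌ B^temp(U)`
  let E : BTemp cS.G ≌ BTemp U :=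
    cS.equiv.symm.trans (((S.etaleEquiv uniformSplitting_holds h36 hcoh hS).trans
      (Over.postEquiv (⟨S, hS⟩ : BTempCat 𝒢) c.equiv)).trans F.asEquivalence)
  haveI : SecondCountableTopology U := TopologicalSpace.Subtype.secondCountableTopology _
  obtain ⟨φ, ψ, hψφ, hφψ, ⟨iφ⟩, -⟩ := BTemp.exists_compatIso_of_equivalence cS.isTempered hUt E
  exact ⟨φ, ψ, hψφ, hφψ, ⟨iφ⟩⟩

/-- **`π₁^temp(G_S) ↪ π₁^temp(G)` is an open embedding onto the stabiliser of a point of `S`**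
([SemiAnbd] Prop. 3.6 (v) p. 39: the morphism `B^temp(G_S) → B^temp(G)` is étale, i.e. `π₁^temp(G_S)`
"is" an open subgroup of `π₁^temp(G)`): with notation as in `exists_chartGroup_compatIso`, there is a
continuous homomorphism `ι : π₁^temp(G_S) → Π` which is an open topological embedding with image
exactly `Stab_Π(x₀)`. [cite: MochizukiSemiAnbd2006, Prop 3.6(v) p.39] -/
theorem exists_isOpenEmbedding_chartGroup (h36 : 𝒢.Prop36Hypotheses) (hcoh : 𝒢.IsCoherent)
    (c : TemperedPiChart 𝒢) (S : CovObj 𝒢) (hS : S.IsTempered)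
    (hSc : IsConnectedObj (⟨S, hS⟩ : BTempCat 𝒢)) (cS : TemperedPiChart S.coveringGraph)
    (ω₀ : BTemp.Orbits (c.equiv.functor.obj ⟨S, hS⟩)) :
    ∃ ι : cS.G →ₜ* c.G, IsOpenEmbedding ι ∧
      ι.toMonoidHom.range = BTemp.stab (c.equiv.functor.obj ⟨S, hS⟩) (Quot.out ω₀) := by
  obtain ⟨φ, ψ, hψφ, hφψ, -⟩ := exists_chartGroup_compatIso h36 hcoh c S hS hSc cS ω₀
  let U : Subgroup c.G := BTemp.stab (c.equiv.functor.obj ⟨S, hS⟩) (Quot.out ω₀)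
  have hUo : IsOpen (U : Set c.G) := (c.equiv.functor.obj ⟨S, hS⟩).property.2 _
  -- `ψ` is a homeomorphism onto `U`
  let e : cS.G ≃ₜ U :=
    { toFun := ψ, invFun := φ, left_inv := hφψ, right_inv := hψφ,
      continuous_toFun := ψ.continuous, continuous_invFun := φ.continuous }
  refine ⟨(ContinuousMonoidHom.mk U.subtype continuous_subtype_val).comp ψ, ?_, ?_⟩
  · change IsOpenEmbedding (((↑) : U → c.G) ∘ e)
    exact (hUo.isOpenEmbedding_subtypeVal).comp e.isOpenEmbedding
  · ext x
    constructor
    · rintro ⟨y, rfl⟩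
      exact (ψ y).2
    · intro hx
      exact ⟨φ ⟨x, hx⟩, by
        change ((ψ (φ ⟨x, hx⟩) : U) : c.G) = x
        rw [hψφ]⟩

end CovObj

end ProfiniteSemiGraph

end Literature.AnabelianGeometry.SemiGraphs

end
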